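import Mathlib.Analysis.SpecificLimits.Basic
import HarnessLib

/-!
# Cluster sets of tight, asymptotically continuous sequences admit no closed partition (abstract topology)
# (support file 1/3 of F4 `stub_clusterPointUnique`, crux `ExistsScaleCovariantLimit`, item stmt-CriticalPhenomena-1981,
# line `folded-current-repulsion`)

Route `HyperoctahedralRP` / `GaussianScaleMixture` (sub-problem `CriticalPhenomena/Ising3DConformalLimit`), crux
`Summit.CriticalPhenomena.Ising3DConformalLimit.Theses.HyperoctahedralRP.ExistsScaleCovariantLimit`. This is the
ABSTRACT part of the reduction `item 5955 ∧ item 4659 ⟹ ClusterPointUnique` (registered sub-goal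
`clusterPointUnique_of_orbitPrecompact_of_totallyDisconnected`, file
`Theorems/HyperoctahedralRPExistsScaleCovariantLimitFoldedCurrentUniqueness.lean`): the classical fact that the
`ω`-limit set of an asymptotically slow orbit with precompact tail is connected, in the form the reduction consumes.

Setting: a type `X` with a countable family of pseudo-metrics `D j : X → X → ℝ` (vanishing on the diagonal, symmetric,
triangle inequality), non-decreasing in `j`; convergence `x_k → S` means `D j (x k) S → 0` for every `j`; the CLUSTER
SET `C` of a sequence `y` is the set of limits of its subsequences (passed as a hypothesis `hC`, no definition). For a
sequence which is TIGHT (every subsequence has a convergent subsequence) and ASYMPTOTICALLY CONTINUOUS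
(`D j (y m) (y (m+1)) → 0` for every `j`):
* `exists_conv_of_mem_clusterSet` — the cluster set is sequentially compact (diagonal argument);
* `clusterSet_partition_false` (registered sub-goal; `clusterSet_partition_false'` with named hypotheses) — the
  cluster set admits no partition into two nonempty parts each closed under
  limits from the cluster set (the parts are uniformly `ε`-separated in some `D j`; the sequence is eventually in the
  `ε/3`-neighbourhood of their union and frequently near each part, so it jumps by `> ε/3` frequently
  (`frequently_and_succ`), contradicting asymptotic continuity).

Reference: folklore (connectedness of `ω`-limit sets; e.g. H. L. Smith, *Monotone Dynamical Systems*, AMS 1995, §1.1).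
No definitions; no `sorry`.
-/

noncomputable section

namespace Summit.CriticalPhenomena.Ising3DConformalLimit.Cruxes.ExistsScaleCovariantLimit.FoldedCurrentRepulsion

open Filter Set
open scoped Topology

namespace Uniqueness

section Abstract

variable {X : Type*} {D : ℕ → X → X → ℝ}

/-- A symmetric function satisfying the triangle inequality and vanishing on the diagonal is nonnegative. [folklore] -/
theorem pm_nonneg (hD0 : ∀ j x, D j x x = 0) (hDc : ∀ j x y, D j x y = D j y x)
    (hDt : ∀ j x y z, D j x z ≤ D j x y + D j y z) (j : ℕ) (x y : X) : 0 ≤ D j x y := by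
  have h := hDt j x y x
  rw [hD0, hDc j y x] at h
  linarith

/-- A subsequence of a convergent sequence converges. [folklore] -/
theorem conv_subseq {x : ℕ → X} {S : X} (h : ∀ j, Tendsto (fun k => D j (x k) S) atTop (𝓝 0)) {φ : ℕ → ℕ}
    (hφ : StrictMono φ) : ∀ j, Tendsto (fun k => D j (x (φ k)) S) atTop (𝓝 0) :=
  fun j => (h j).comp hφ.tendsto_atTop

/-- A sequence asymptotic to a convergent sequence converges to the same limit. [folklore] -/
theorem conv_of_near (hD0 : ∀ j x, D j x x = 0) (hDc : ∀ j x y, D j x y = D j y x)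
    (hDt : ∀ j x y z, D j x z ≤ D j x y + D j y z) {x x' : ℕ → X} {S : X}
    (h : ∀ j, Tendsto (fun k => D j (x k) S) atTop (𝓝 0))
    (hn : ∀ j, Tendsto (fun k => D j (x k) (x' k)) atTop (𝓝 0)) :
    ∀ j, Tendsto (fun k => D j (x' k) S) atTop (𝓝 0) := by
  intro j
  have h2 : Tendsto (fun k => D j (x k) (x' k) + D j (x k) S) atTop (𝓝 0) := by
    simpa using (hn j).add (h j)
  refine squeeze_zero (fun k => pm_nonneg hD0 hDc hDt j _ _) (fun k => ?_) h2
  calc D j (x' k) S ≤ D j (x' k) (x k) + D j (x k) S := hDt j _ _ _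
    _ = D j (x k) (x' k) + D j (x k) S := by rw [hDc j (x' k)]

/-- Two sequences with a common limit are asymptotic. [folklore] -/
theorem near_of_conv (hD0 : ∀ j x, D j x x = 0) (hDc : ∀ j x y, D j x y = D j y x)
    (hDt : ∀ j x y z, D j x z ≤ D j x y + D j y z) {x x' : ℕ → X} {S : X}
    (h : ∀ j, Tendsto (fun k => D j (x k) S) atTop (𝓝 0)) (h' : ∀ j, Tendsto (fun k => D j (x' k) S) atTop (𝓝 0))
    (j : ℕ) : Tendsto (fun k => D j (x k) (x' k)) atTop (𝓝 0) := by
  have h2 : Tendsto (fun k => D j (x k) S + D j (x' k) S) atTop (𝓝 0) := by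
    simpa using (h j).add (h' j)
  refine squeeze_zero (fun k => pm_nonneg hD0 hDc hDt j _ _) (fun k => ?_) h2
  calc D j (x k) (x' k) ≤ D j (x k) S + D j S (x' k) := hDt j _ _ _
    _ = D j (x k) S + D j (x' k) S := by rw [hDc j S]

/-- **The cluster set of a tight sequence is sequentially compact**: every sequence in the cluster set has a
subsequence converging to a point of the cluster set (diagonal argument; the family `D` is non-decreasing in its
index). [folklore] -/
theorem exists_conv_of_mem_clusterSet (hD0 : ∀ j x, D j x x = 0) (hDc : ∀ j x y, D j x y = D j y x)
    (hDt : ∀ j x y z, D j x z ≤ D j x y + D j y z) (hDm : ∀ x y, Monotone fun j => D j x y) {y : ℕ → X}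
    (hT : ∀ φ : ℕ → ℕ, StrictMono φ → ∃ ψ : ℕ → ℕ, StrictMono ψ ∧ ∃ S,
      ∀ j, Tendsto (fun k => D j (y (φ (ψ k))) S) atTop (𝓝 0))
    {C : Set X} (hC : ∀ S, S ∈ C ↔ ∃ φ : ℕ → ℕ, StrictMono φ ∧ ∀ j, Tendsto (fun k => D j (y (φ k)) S) atTop (𝓝 0))
    {a : ℕ → X} (ha : ∀ j, a j ∈ C) :
    ∃ κ : ℕ → ℕ, StrictMono κ ∧ ∃ S ∈ C, ∀ j, Tendsto (fun k => D j (a (κ k)) S) atTop (𝓝 0) := by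
  -- indices `m j ≥ j` with `D j (y (m j)) (a j) < 1/(j+1)`
  have hm : ∀ j, ∃ m : ℕ, j ≤ m ∧ D j (y m) (a j) < 1 / ((j:ℝ) + 1) := by
    intro j
    obtain ⟨φ, hφ, hc⟩ := (hC _).1 (ha j)
    have h1 : ∀ᶠ k in atTop, D j (y (φ k)) (a j) < 1 / ((j:ℝ) + 1) :=
      (tendsto_order.1 (hc j)).2 _ (by positivity)
    have h2 : ∀ᶠ k in atTop, j ≤ φ k :=
      (eventually_ge_atTop j).mono fun k hk => hk.trans (hφ.id_le k)
    obtain ⟨k, hk1, hk2⟩ := (h1.and h2).exists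
    exact ⟨φ k, hk2, hk1⟩
  choose m hmj hmD using hm
  obtain ⟨κ₀, hκ₀, hmκ₀⟩ := strictMono_subseq_of_id_le hmj
  obtain ⟨ψ, hψ, S, hS⟩ := hT (m ∘ κ₀) hmκ₀
  refine ⟨κ₀ ∘ ψ, hκ₀.comp hψ, S, (hC S).2 ⟨(m ∘ κ₀) ∘ ψ, hmκ₀.comp hψ, hS⟩, ?_⟩
  intro i
  have hψi : ∀ l, l ≤ κ₀ (ψ l) := fun l => (hψ.id_le l).trans (hκ₀.id_le _)
  have h1 : Tendsto (fun l => D i (a (κ₀ (ψ l))) (y (m (κ₀ (ψ l))))) atTop (𝓝 0) := by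
    refine squeeze_zero' (Eventually.of_forall fun l => pm_nonneg hD0 hDc hDt i _ _) ?_
      tendsto_one_div_add_atTop_nhds_zero_nat
    filter_upwards [eventually_ge_atTop i] with l hl
    have hil : i ≤ κ₀ (ψ l) := hl.trans (hψi l)
    calc D i (a (κ₀ (ψ l))) (y (m (κ₀ (ψ l))))
        ≤ D (κ₀ (ψ l)) (a (κ₀ (ψ l))) (y (m (κ₀ (ψ l)))) := hDm _ _ hil
      _ = D (κ₀ (ψ l)) (y (m (κ₀ (ψ l)))) (a (κ₀ (ψ l))) := hDc _ _ _
      _ ≤ 1 / (((κ₀ (ψ l) : ℕ) : ℝ) + 1) := (hmD _).le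
      _ ≤ 1 / ((l:ℝ) + 1) := by
          gcongr
          exact_mod_cast hψi l
  have h2 : Tendsto (fun l => D i (a (κ₀ (ψ l))) (y (m (κ₀ (ψ l)))) + D i (y (m (κ₀ (ψ l)))) S)
      atTop (𝓝 0) := by simpa using h1.add (hS i)
  exact squeeze_zero (fun l => pm_nonneg hD0 hDc hDt i _ _) (fun l => hDt i _ _ _) h2

/-- Combinatorics of transitions: if eventually `P m ∨ Q m`, and both `P` and `Q` hold frequently, then frequently
`P m ∧ Q (m+1)`. [folklore] -/
theorem frequently_and_succ {P Q : ℕ → Prop} (hPQ : ∀ᶠ m in atTop, P m ∨ Q m) (hP : ∃ᶠ m in atTop, P m)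
    (hQ : ∃ᶠ m in atTop, Q m) : ∃ᶠ m in atTop, P m ∧ Q (m + 1) := by
  classical
  rw [frequently_atTop]
  intro M
  obtain ⟨N, hN⟩ := eventually_atTop.1 hPQ
  obtain ⟨m₁, hm₁, hP₁⟩ := (frequently_atTop.1 hP) (max M N)
  obtain ⟨m₂, hm₂, hQ₂⟩ := (frequently_atTop.1 hQ) (m₁ + 1)
  -- the first index after `m₁` at which `P` fails or `Q` holds
  have hex : ∃ m, m₁ < m ∧ (¬ P m ∨ Q m) := ⟨m₂, by omega, Or.inr hQ₂⟩
  set m₀ := Nat.find hex with hm₀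
  have hm₀s : m₁ < m₀ ∧ (¬ P m₀ ∨ Q m₀) := Nat.find_spec hex
  have hmin : ∀ m, m < m₀ → ¬ (m₁ < m ∧ (¬ P m ∨ Q m)) := fun m hm => Nat.find_min hex hm
  refine ⟨m₀ - 1, by omega, ?_, ?_⟩
  · -- `P (m₀ - 1)`
    by_cases h : m₀ - 1 = m₁
    · rw [h]; exact hP₁
    · have h' := hmin (m₀ - 1) (by omega)
      by_contra hP
      exact h' ⟨by omega, Or.inl hP⟩
  · -- `Q m₀`
    have e : m₀ - 1 + 1 = m₀ := by omega
    rw [e]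
    rcases hm₀s.2 with h | h
    · exact (hN m₀ (by omega)).resolve_left h
    · exact h

/-- **Connectedness of the cluster set (abstract form).** Let `y` be a sequence which is TIGHT (every subsequence has
a convergent subsequence) and ASYMPTOTICALLY CONTINUOUS (`D j (y m) (y (m+1)) → 0`) for a non-decreasing countable
family of pseudo-metrics `D`. Then its cluster set admits no partition into two nonempty parts each closed under limits
from the cluster set. (Classical: the `ω`-limit set of an asymptotically slow orbit with precompact tail is connected.)
[folklore] -/
theorem clusterSet_partition_false' (hD0 : ∀ j x, D j x x = 0) (hDc : ∀ j x y, D j x y = D j y x)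
    (hDt : ∀ j x y z, D j x z ≤ D j x y + D j y z) (hDm : ∀ x y, Monotone fun j => D j x y) {y : ℕ → X}
    (hT : ∀ φ : ℕ → ℕ, StrictMono φ → ∃ ψ : ℕ → ℕ, StrictMono ψ ∧ ∃ S,
      ∀ j, Tendsto (fun k => D j (y (φ (ψ k))) S) atTop (𝓝 0))
    (hAC : ∀ j, Tendsto (fun m => D j (y m) (y (m + 1))) atTop (𝓝 0))
    {C : Set X} (hC : ∀ S, S ∈ C ↔ ∃ φ : ℕ → ℕ, StrictMono φ ∧ ∀ j, Tendsto (fun k => D j (y (φ k)) S) atTop (𝓝 0))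
    {A B : Set X} (hA : A ⊆ C) (hB : B ⊆ C) (hcov : C ⊆ A ∪ B) (hdisj : ∀ S ∈ A, S ∉ B)
    (hAcl : ∀ (a : ℕ → X) (S : X), (∀ k, a k ∈ A) → S ∈ C →
      (∀ j, Tendsto (fun k => D j (a k) S) atTop (𝓝 0)) → S ∈ A)
    (hBcl : ∀ (b : ℕ → X) (S : X), (∀ k, b k ∈ B) → S ∈ C →
      (∀ j, Tendsto (fun k => D j (b k) S) atTop (𝓝 0)) → S ∈ B)
    (hAne : A.Nonempty) (hBne : B.Nonempty) : False := by
  have hnn := pm_nonneg hD0 hDc hDt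
  -- Step 1: uniform separation of `A` and `B` in one of the pseudo-metrics
  have hsep : ∃ (j : ℕ) (ε : ℝ), 0 < ε ∧ ∀ a ∈ A, ∀ b ∈ B, ε ≤ D j a b := by
    by_contra h
    push Not at h
    choose a ha b hb hab using fun j : ℕ => h j (1 / ((j:ℝ) + 1)) (by positivity)
    obtain ⟨κ, hκ, S, hS, haS⟩ :=
      exists_conv_of_mem_clusterSet hD0 hDc hDt hDm hT hC (fun j => hA (ha j))
    have hSA : S ∈ A := hAcl (a ∘ κ) S (fun k => ha _) hS haS
    have hbS : ∀ j, Tendsto (fun k => D j (b (κ k)) S) atTop (𝓝 0) := by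
      refine conv_of_near hD0 hDc hDt haS fun j => ?_
      refine squeeze_zero' (Eventually.of_forall fun l => hnn j _ _) ?_ tendsto_one_div_add_atTop_nhds_zero_nat
      filter_upwards [eventually_ge_atTop j] with l hl
      have hjl : j ≤ κ l := hl.trans (hκ.id_le l)
      calc D j (a (κ l)) (b (κ l)) ≤ D (κ l) (a (κ l)) (b (κ l)) := hDm _ _ hjl
        _ ≤ 1 / (((κ l : ℕ) : ℝ) + 1) := (hab _).le
        _ ≤ 1 / ((l:ℝ) + 1) := by
            gcongr
            exact_mod_cast hκ.id_le l
    exact hdisj S hSA (hBcl (b ∘ κ) S (fun k => hb _) hS hbS)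
  obtain ⟨j, ε, hε, hjε⟩ := hsep
  -- Step 2: the `ε/3`-neighbourhoods of `A` and `B`
  set NA : Set X := {x | ∃ a ∈ A, D j x a < ε / 3} with hNA
  set NB : Set X := {x | ∃ b ∈ B, D j x b < ε / 3} with hNB
  -- eventually the sequence is in `NA ∪ NB`
  have hev : ∀ᶠ m in atTop, y m ∈ NA ∨ y m ∈ NB := by
    by_contra hnot
    obtain ⟨φ, hφ, hbad⟩ := extraction_of_frequently_atTop (not_eventually.1 hnot)
    obtain ⟨ψ, hψ, S, hS⟩ := hT φ hφ
    have hSc : S ∈ C := (hC S).2 ⟨φ ∘ ψ, hφ.comp hψ, hS⟩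
    have hlt : ∀ᶠ l in atTop, D j (y (φ (ψ l))) S < ε / 3 := (tendsto_order.1 (hS j)).2 _ (by positivity)
    obtain ⟨l, hl⟩ := hlt.exists
    rcases hcov hSc with h | h
    · exact hbad (ψ l) (Or.inl ⟨S, h, hl⟩)
    · exact hbad (ψ l) (Or.inr ⟨S, h, hl⟩)
  -- frequently in `NA`, frequently in `NB`
  have hfreq : ∀ {E : Set X}, E ⊆ C → E.Nonempty →
      ∃ᶠ m in atTop, y m ∈ {x | ∃ c ∈ E, D j x c < ε / 3} := by
    intro E hE hEne
    obtain ⟨c, hc⟩ := hEne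
    obtain ⟨φ, hφ, hconv⟩ := (hC c).1 (hE hc)
    have hlt : ∀ᶠ l in atTop, D j (y (φ l)) c < ε / 3 := (tendsto_order.1 (hconv j)).2 _ (by positivity)
    exact hφ.tendsto_atTop.frequently (hlt.mono fun l hl => ⟨c, hc, hl⟩).frequently
  have hfA : ∃ᶠ m in atTop, y m ∈ NA := hfreq hA hAne
  have hfB : ∃ᶠ m in atTop, y m ∈ NB := hfreq hB hBne
  -- transitions `y m ∈ NA`, `y (m+1) ∈ NB` force `D j (y m) (y (m+1)) > ε/3` frequently
  have htrans := frequently_and_succ hev hfA hfB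
  have hsmall : ∀ᶠ m in atTop, D j (y m) (y (m + 1)) < ε / 3 := (tendsto_order.1 (hAC j)).2 _ (by positivity)
  obtain ⟨m, ⟨⟨a, haA, hma⟩, ⟨b, hbB, hmb⟩⟩, hm⟩ := (htrans.and_eventually hsmall).exists
  have h1 := hjε a haA b hbB
  have h2 : D j a b ≤ D j a (y m) + D j (y m) (y (m + 1)) + D j (y (m + 1)) b :=
    (hDt j a (y m) b).trans (by linarith [hDt j (y m) (y (m + 1)) b])
  rw [hDc j a (y m)] at h2
  linarith

/-- **CLUSTER SETS OF TIGHT, ASYMPTOTICALLY CONTINUOUS SEQUENCES ADMIT NO CLOSED PARTITION** (registered sub-goal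
`clusterSet_partition_false` of line `folded-current-repulsion`; `clusterSet_partition_false'` with all data and
hypotheses universally quantified). [folklore] -/
theorem clusterSet_partition_false : ∀ {X : Type*} {D : ℕ → X → X → ℝ} {y : ℕ → X} {C A B : Set X},
    (∀ j x, D j x x = 0) → (∀ j x x', D j x x' = D j x' x) → (∀ j x x' x'', D j x x'' ≤ D j x x' + D j x' x'') →
    (∀ x x', Monotone fun j => D j x x') →
    (∀ φ : ℕ → ℕ, StrictMono φ → ∃ ψ : ℕ → ℕ, StrictMono ψ ∧ ∃ S,
      ∀ j, Filter.Tendsto (fun k => D j (y (φ (ψ k))) S) Filter.atTop (nhds 0)) →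
    (∀ j, Filter.Tendsto (fun m => D j (y m) (y (m + 1))) Filter.atTop (nhds 0)) →
    (∀ S, S ∈ C ↔ ∃ φ : ℕ → ℕ, StrictMono φ ∧ ∀ j, Filter.Tendsto (fun k => D j (y (φ k)) S) Filter.atTop (nhds 0)) →
    A ⊆ C → B ⊆ C → C ⊆ A ∪ B → (∀ S ∈ A, S ∉ B) →
    (∀ (a : ℕ → X) (S : X), (∀ k, a k ∈ A) → S ∈ C →
      (∀ j, Filter.Tendsto (fun k => D j (a k) S) Filter.atTop (nhds 0)) → S ∈ A) →
    (∀ (b : ℕ → X) (S : X), (∀ k, b k ∈ B) → S ∈ C →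
      (∀ j, Filter.Tendsto (fun k => D j (b k) S) Filter.atTop (nhds 0)) → S ∈ B) →
    A.Nonempty → B.Nonempty → False :=
  fun hD0 hDc hDt hDm hT hAC hC hA hB hcov hdisj hAcl hBcl hAne hBne =>
    clusterSet_partition_false' hD0 hDc hDt hDm hT hAC hC hA hB hcov hdisj hAcl hBcl hAne hBne

end Abstract

end Uniqueness

end Summit.CriticalPhenomena.Ising3DConformalLimit.Cruxes.ExistsScaleCovariantLimit.FoldedCurrentRepulsion

end
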